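import Literature.NumberTheory.Sieve.PowTwoRieszProductCertificate
import HarnessLib

/-!
# Large deviations of `G_L(α) = ∑ e(2^ν α)`: the qualitative Linnik–Gallagher lemma, PROVED

Topic `Literature/NumberTheory/Sieve`, namespace `Literature.NumberTheory.Sieve.PintzRuzsa2003`
(continuation of `PowTwoCosSumMoments.lean`, `PowTwoExpSumLargeDeviation.lean`,
`PowTwoRieszProductCertificate.lean`).

The set `𝒜_λ = {α ∈ [0,1] : |G_L(α)| ≥ λL}`, `G_L(α) = ∑_{1 ≤ ν ≤ L} e(2^ν α)` (tree: `powSumL`), where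
the generating function of the powers of two is large has measure `≪ N^{−E(λ)}` (`N = 2^L`), and
Heath-Brown–Puchta [HeathbrownPuchta2002, §7 (42)–(44)] show that one may take
`E(λ) = ξλ/log 2 − log F(ξ,h)/(h log 2) − ε` for ANY `h ∈ ℕ`, `ξ > 0`, `ε > 0`, with
`F(ξ,h) = 2^{−h} ∑_{r<2^h} exp{ξ Re T_h(r/2^h)}` (the tree's `discMoment ξ h`).  In particular
`E(λ) → 1` as `λ → 1` — the qualitative large-deviation lemma of Linnik and Gallagher on which every
proof of Linnik's «`p + p' + K` powers of two» theorem rests ([HeathbrownPuchta2002, §1, Lemma 1 and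
the display after it: Liu–Liu–Wang's `E(1−η) ≥ 1 − F(κη) − F(1−κη) + o(1)`]).  This file PROVES
that qualitative form,

  `gallagherLargeDeviationQual : ∀ c < 1, ∃ λ < 1, ∃ L₀, ∀ L ≥ L₀, |𝒜_λ(L)| ≤ 2^{−cL}`,

VERBATIM the crux «GallagherLargeDeviationQual» of the parity-ideate route `LinnikGallagherMV`, from the
tree's Chernoff frame `measureReal_norm_powSumL_ge_le`
(`|𝒜| ≤ e^{−ξλL}(4(⌈(ξL)²⌉+1) E_L(ξ) + 8/3)`), the sub-multiplicativity
`expMoment_le_pow_mul_exp` (`E_L ≤ (E*_M)^{⌊L/M⌋} e^{ξ(L mod M)}`, [PintzRuzsa2003, §4 Thm 2(b)]) and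
ONE crude evaluation of the discrete moment: for `0 < k < 2^M` the term `j = M − 1 − v₂(k)` of
`S_M(k/2^M)` is `cos(π · odd) = −1`, so `S_M(k/2^M) ≤ M − 2` (`cosSum_dyadic_le`) and
`E*_M(ξ) ≤ 2^{−M} e^{ξM} + e^{ξ(M−2)}` (`discMoment_le_crude`), `= 2^{1−M} e^{ξM}` at `e^{2ξ} = 2^M`.
With `M > 2/(1−c)`, `ξ = (M log 2)/2`, `λ = 1 − (1−c)/(2M)` the Chernoff exponent beats `c log 2` by
at least `(1−c)(log 2)/4`, and the polynomial factor is absorbed for `L ≥ L₀`.  No new facts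
(0 `def … : Prop`).  Written for the parity-ideate cell (route `LinnikGallagherMV`, crux
stmt-Parity-20513; literature seat g15, 2026-08-27).

## References

* [HeathbrownPuchta2002] D. R. Heath-Brown, J.-C. Puchta, *Integers represented as a sum of primes
  and powers of two*, Asian J. Math. 6 (2002) 535–565 (arXiv:math/0201299): §1 Lemma 1 and the
  following display (`𝒜_λ`, `E(λ)`), §7 (42)–(44) (`E(λ) = ξλ/log 2 − log F(ξ,h)/(h log 2) − ε`).
* [PintzRuzsa2003] J. Pintz, I. Z. Ruzsa, *On Linnik's approximation to Goldbach's problem, I*,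
  Acta Arith. 109 (2003) 169–194: §4 Theorem 2(b), Lemma 4, §7 (7.1).

## Mathlib / tree search

Tree: `cosSum`, `cosSum_le`, `discMoment`, `expMoment`, `discMoment_nonneg`,
`expMoment_le_pow_mul_exp` (`PowTwoCosSumMoments`); `measureReal_norm_powSumL_ge_le`
(`PowTwoRieszProductCertificate`); `powSumL` (`GoldbachLinnikDirectRoute`).
Mathlib: `Nat.exists_eq_two_pow_mul_odd`, `Real.cos_nat_mul_pi`, `Real.pow_div_factorial_le_exp`,
`Real.exp_nat_mul`, `Real.rpow_def_of_pos`.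
`lean search 'LargeDeviationQual|gallagherLargeDeviation'`: nothing before this file.
-/

noncomputable section

open Finset Filter MeasureTheory Real
open scoped Topology

namespace Literature.NumberTheory.Sieve

namespace PintzRuzsa2003

open GoldbachLinnik

/-! ### The crude evaluation of the discrete moment -/

/-- **At a dyadic point `k/2^M`, `0 < k < 2^M`, one cosine of `S_M` equals `−1`**: writing
`k = 2^a k'` with `k'` odd (`a < M`), the term `j = M − 1 − a` is `cos(2π · 2^{M−1−a} · 2^a k'/2^M) =
cos(π k') = −1`, whence `S_M(k/2^M) ≤ M − 2`.
[cite: HeathbrownPuchta2002, §7 (44) (the sum F(ξ,h) over the points r/2^h)] -/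
theorem cosSum_dyadic_le {M k : ℕ} (hk0 : 0 < k) (hk : k < 2 ^ M) :
    cosSum M ((k : ℝ) / 2 ^ M) ≤ (M : ℝ) - 2 := by
  obtain ⟨a, k', hk', rfl⟩ := Nat.exists_eq_two_pow_mul_odd hk0.ne'
  have hk'pos : 0 < k' := hk'.pos
  -- `a < M`
  have ha : a < M := by
    by_contra h
    push Not at h
    have h1 : 2 ^ M ≤ 2 ^ a := Nat.pow_le_pow_right two_pos h
    have h2 : 2 ^ a ≤ 2 ^ a * k' := Nat.le_mul_of_pos_right _ hk'pos
    omega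
  have hM1 : 1 ≤ M := by omega
  -- split off the term `j₀ = M − 1 − a`
  set j₀ : ℕ := M - 1 - a with hj₀
  have hj₀M : j₀ ∈ range M := by rw [mem_range]; omega
  have h2M : (2 : ℝ) ^ M = 2 ^ j₀ * 2 ^ a * 2 := by
    rw [show M = j₀ + a + 1 by omega, pow_add, pow_add, pow_one]
  unfold cosSum
  rw [← add_sum_erase _ _ hj₀M]
  have hcos : Real.cos (2 * π * 2 ^ j₀ * (((2 ^ a * k' : ℕ) : ℝ) / 2 ^ M)) = -1 := by
    have e : 2 * π * 2 ^ j₀ * (((2 ^ a * k' : ℕ) : ℝ) / 2 ^ M) = (k' : ℝ) * π := by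
      rw [h2M]
      push_cast
      field_simp
    rw [e, Real.cos_nat_mul_pi]
    exact hk'.neg_one_pow
  rw [hcos]
  have hrest : ∑ j ∈ (range M).erase j₀, Real.cos (2 * π * 2 ^ j * (((2 ^ a * k' : ℕ) : ℝ) / 2 ^ M)) ≤
      (M : ℝ) - 1 := by
    calc ∑ j ∈ (range M).erase j₀, Real.cos (2 * π * 2 ^ j * (((2 ^ a * k' : ℕ) : ℝ) / 2 ^ M))
        ≤ ∑ j ∈ (range M).erase j₀, (1 : ℝ) := sum_le_sum fun j _ => Real.cos_le_one _
      _ = (M : ℝ) - 1 := by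
          rw [sum_const, card_erase_of_mem hj₀M, card_range, nsmul_eq_mul, mul_one,
            Nat.cast_sub hM1, Nat.cast_one]
  linarith

/-- **The crude bound for the discrete moment**: for `ξ ≥ 0`,
`E*_M(ξ) = 2^{−M} ∑_{k<2^M} e^{ξ S_M(k/2^M)} ≤ 2^{−M} e^{ξM} + e^{ξ(M−2)}` (the point `k = 0` carries
`S_M = M`, every other point `S_M ≤ M − 2`).
[cite: HeathbrownPuchta2002, §7 (43)–(44) (F(ξ,h) as a finite sum over r/2^h)] -/
theorem discMoment_le_crude {ξ : ℝ} (hξ : 0 ≤ ξ) (M : ℕ) :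
    discMoment ξ M ≤ ((2 : ℝ) ^ M)⁻¹ * Real.exp (ξ * M) + Real.exp (ξ * ((M : ℝ) - 2)) := by
  unfold discMoment
  have hQ : (0 : ℝ) < (2 : ℝ) ^ M := by positivity
  have h0 : 0 ∈ range (2 ^ M) := mem_range.mpr (by positivity)
  rw [← add_sum_erase _ _ h0]
  -- the point `0`
  have hterm0 : Real.exp (ξ * cosSum M (((0 : ℕ) : ℝ) / 2 ^ M)) ≤ Real.exp (ξ * M) :=
    Real.exp_le_exp.mpr (mul_le_mul_of_nonneg_left (cosSum_le M _) hξ)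
  -- the other points
  have hrest : ∑ k ∈ (range (2 ^ M)).erase 0, Real.exp (ξ * cosSum M ((k : ℝ) / 2 ^ M)) ≤
      ∑ k ∈ (range (2 ^ M)).erase 0, Real.exp (ξ * ((M : ℝ) - 2)) := by
    refine sum_le_sum fun k hk => ?_
    obtain ⟨hk0, hkr⟩ := mem_erase.mp hk
    exact Real.exp_le_exp.mpr (mul_le_mul_of_nonneg_left
      (cosSum_dyadic_le (Nat.pos_of_ne_zero hk0) (mem_range.mp hkr)) hξ)
  rw [sum_const, card_erase_of_mem h0, card_range, nsmul_eq_mul] at hrest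
  have hcard : ((2 ^ M - 1 : ℕ) : ℝ) ≤ (2 : ℝ) ^ M := by exact_mod_cast Nat.sub_le _ _
  have hE : 0 ≤ Real.exp (ξ * ((M : ℝ) - 2)) := (Real.exp_pos _).le
  calc ((2 : ℝ) ^ M)⁻¹ * (Real.exp (ξ * cosSum M (((0 : ℕ) : ℝ) / 2 ^ M)) +
          ∑ k ∈ (range (2 ^ M)).erase 0, Real.exp (ξ * cosSum M ((k : ℝ) / 2 ^ M)))
      ≤ ((2 : ℝ) ^ M)⁻¹ * (Real.exp (ξ * M) + ((2 ^ M - 1 : ℕ) : ℝ) * Real.exp (ξ * ((M : ℝ) - 2))) := by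
        gcongr
    _ ≤ ((2 : ℝ) ^ M)⁻¹ * (Real.exp (ξ * M) + (2 : ℝ) ^ M * Real.exp (ξ * ((M : ℝ) - 2))) := by
        gcongr
    _ = ((2 : ℝ) ^ M)⁻¹ * Real.exp (ξ * M) + Real.exp (ξ * ((M : ℝ) - 2)) := by
        field_simp

/-- **The discrete moment at `e^{2ξ} = 2^M`**: with `ξ = (M log 2)/2`,
`E*_M(ξ) ≤ 2 · 2^{−M} e^{ξM} = e^{(ξ − log 2 + (log 2)/M) M}` (`M ≥ 1`).
[cite: HeathbrownPuchta2002, §7 (42)–(44) (E(λ) = ξλ/log 2 − log F(ξ,h)/(h log 2) − ε)] -/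
theorem discMoment_le_exp_rate {M : ℕ} (hM : 1 ≤ M) :
    discMoment ((M : ℝ) * Real.log 2 / 2) M ≤
      Real.exp (((M : ℝ) * Real.log 2 / 2 - Real.log 2 + Real.log 2 / M) * M) := by
  set ξ : ℝ := (M : ℝ) * Real.log 2 / 2 with hξ
  have hlg : 0 < Real.log 2 := Real.log_pos one_lt_two
  have hξ0 : 0 ≤ ξ := by positivity
  have hM0 : (0 : ℝ) < M := by exact_mod_cast hM
  -- `e^{2ξ} = 2^M`, so `e^{ξ(M−2)} = 2^{−M} e^{ξM}`
  have h2M : Real.exp ((M : ℝ) * Real.log 2) = (2 : ℝ) ^ M := by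
    rw [Real.exp_nat_mul, Real.exp_log two_pos]
  have hsplit : Real.exp (ξ * ((M : ℝ) - 2)) = ((2 : ℝ) ^ M)⁻¹ * Real.exp (ξ * M) := by
    rw [← h2M, ← Real.exp_neg, ← Real.exp_add]
    congr 1
    rw [hξ]; ring
  have htarget : Real.exp ((ξ - Real.log 2 + Real.log 2 / M) * M) =
      2 * (((2 : ℝ) ^ M)⁻¹ * Real.exp (ξ * M)) := by
    rw [← h2M, ← Real.exp_neg, ← Real.exp_add]
    have e : (ξ - Real.log 2 + Real.log 2 / M) * M = Real.log 2 + (-((M : ℝ) * Real.log 2) + ξ * M) := by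
      field_simp
      ring
    rw [e, Real.exp_add, Real.exp_log two_pos]
  rw [htarget]
  calc discMoment ξ M ≤ ((2 : ℝ) ^ M)⁻¹ * Real.exp (ξ * M) + Real.exp (ξ * ((M : ℝ) - 2)) :=
        discMoment_le_crude hξ0 M
    _ = 2 * (((2 : ℝ) ^ M)⁻¹ * Real.exp (ξ * M)) := by rw [hsplit]; ring

/-- **The exponential moment at that rate**: with `ξ = (M log 2)/2`, `ℓ = ξ − log 2 + (log 2)/M`
(`M ≥ 2`, so `ℓ ≥ 0`), `E_L(ξ) ≤ e^{ξM} e^{ℓL}` for every `L`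
(`E_L ≤ (E*_M)^{⌊L/M⌋} e^{ξ (L mod M)}`). [cite: PintzRuzsa2003, §4 Thm 2(b) (4.2); HeathbrownPuchta2002, §7 (42)–(44)] -/
theorem expMoment_le_exp_rate {M : ℕ} (hM : 2 ≤ M) (L : ℕ) :
    expMoment ((M : ℝ) * Real.log 2 / 2) L ≤
      Real.exp ((M : ℝ) * Real.log 2 / 2 * M) *
        Real.exp (((M : ℝ) * Real.log 2 / 2 - Real.log 2 + Real.log 2 / M) * L) := by
  set ξ : ℝ := (M : ℝ) * Real.log 2 / 2 with hξ
  set ℓ : ℝ := ξ - Real.log 2 + Real.log 2 / M with hℓ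
  have hlg : 0 < Real.log 2 := Real.log_pos one_lt_two
  have hM0 : (0 : ℝ) < M := by positivity
  have hM2 : (2 : ℝ) ≤ M := by exact_mod_cast hM
  have hξ0 : 0 ≤ ξ := by positivity
  have hℓ0 : 0 ≤ ℓ := by
    -- `ℓ = log 2 · (M/2 − 1 + 1/M) ≥ 0`
    have e : ℓ = Real.log 2 * ((M : ℝ) / 2 - 1 + 1 / M) := by rw [hℓ, hξ]; ring
    rw [e]
    refine mul_nonneg hlg.le ?_
    have : (0 : ℝ) < 1 / M := by positivity
    linarith
  have hD0 : 0 ≤ discMoment ξ M := discMoment_nonneg ξ M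
  have hD : discMoment ξ M ≤ Real.exp (ℓ * M) := discMoment_le_exp_rate (by omega)
  have h1 := expMoment_le_pow_mul_exp hξ0 M L
  -- `(E*_M)^{⌊L/M⌋} ≤ e^{ℓ M ⌊L/M⌋} ≤ e^{ℓ L}`
  have hpow : discMoment ξ M ^ (L / M) ≤ Real.exp (ℓ * L) := by
    calc discMoment ξ M ^ (L / M) ≤ Real.exp (ℓ * M) ^ (L / M) := pow_le_pow_left₀ hD0 hD _
      _ = Real.exp (((L / M : ℕ) : ℝ) * (ℓ * M)) := (Real.exp_nat_mul _ _).symm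
      _ ≤ Real.exp (ℓ * L) := by
          refine Real.exp_le_exp.mpr ?_
          have hdiv : (((L / M : ℕ) : ℝ)) * M ≤ L := by exact_mod_cast Nat.div_mul_le_self L M
          calc ((L / M : ℕ) : ℝ) * (ℓ * M) = ℓ * (((L / M : ℕ) : ℝ) * M) := by ring
            _ ≤ ℓ * L := mul_le_mul_of_nonneg_left hdiv hℓ0
  -- `e^{ξ (L mod M)} ≤ e^{ξ M}`
  have hmod : Real.exp (ξ * ((L % M : ℕ) : ℝ)) ≤ Real.exp (ξ * M) := by
    refine Real.exp_le_exp.mpr (mul_le_mul_of_nonneg_left ?_ hξ0)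
    exact_mod_cast (Nat.mod_lt L (by omega)).le
  calc expMoment ξ L ≤ discMoment ξ M ^ (L / M) * Real.exp (ξ * ((L % M : ℕ) : ℝ)) := h1
    _ ≤ Real.exp (ℓ * L) * Real.exp (ξ * M) :=
        mul_le_mul hpow hmod (Real.exp_pos _).le (Real.exp_pos _).le
    _ = Real.exp (ξ * M) * Real.exp (ℓ * L) := mul_comm _ _

/-! ### The qualitative large-deviation lemma -/

/-- **Linnik–Gallagher large deviations of `G_L`, qualitative form** — VERBATIM the crux
«GallagherLargeDeviationQual» of the parity-ideate route `LinnikGallagherMV`: for every `c < 1` there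
are `λ < 1` and `L₀` with `|{α ∈ [0,1] : λL ≤ |G_L(α)|}| ≤ 2^{−cL}` for all `L ≥ L₀`
(`G_L = powSumL L`, `G_L(α) = ∑_{1 ≤ ν ≤ L} e(2^ν α)`); i.e. `meas(𝒜_λ) ≪ N^{−E(λ)}` with
`E(λ) → 1` as `λ → 1`.  Here from `E(λ) = ξλ/log 2 − log F(ξ,h)/(h log 2) − ε` at `h = M > 2/(1−c)`,
`e^{2ξ} = 2^M`, `λ = 1 − (1−c)/(2M)`, with the crude `F(ξ,M) ≤ 2^{1−M} e^{ξM}`.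
[cite: HeathbrownPuchta2002, §1 Lemma 1 and §7 (42)–(44); PintzRuzsa2003, §4 Lemma 4 and §7 (7.1)] -/
theorem gallagherLargeDeviationQual :
    ∀ c : ℝ, c < 1 → ∃ lam : ℝ, lam < 1 ∧ ∃ L₀ : ℕ, ∀ L : ℕ, L₀ ≤ L →
      volume.real {α : ℝ | α ∈ Set.Icc (0 : ℝ) 1 ∧
          lam * L ≤ ‖Literature.NumberTheory.Sieve.GoldbachLinnik.powSumL L α‖} ≤
        (2 : ℝ) ^ (-(c * L)) := by
  intro c hc
  -- the parameters
  set δ : ℝ := 1 - c with hδ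
  have hδ0 : 0 < δ := by rw [hδ]; linarith
  set M : ℕ := ⌈2 / δ⌉₊ + 2 with hM
  have hM2 : 2 ≤ M := by omega
  have hM0 : (0 : ℝ) < M := by positivity
  have hMr : 2 / δ < (M : ℝ) := by
    have h := Nat.le_ceil (2 / δ)
    rw [hM]; push_cast; linarith
  have hMinv : 1 / (M : ℝ) < δ / 2 := by
    rw [div_lt_iff₀ hδ0] at hMr
    rw [div_lt_iff₀ hM0]
    linarith
  set lg : ℝ := Real.log 2 with hlg
  have hlg0 : 0 < lg := Real.log_pos one_lt_two
  set ξ : ℝ := (M : ℝ) * lg / 2 with hξ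
  have hξ0 : 0 ≤ ξ := by positivity
  set lam : ℝ := 1 - δ / (2 * M) with hlam
  set ℓ : ℝ := ξ - lg + lg / M with hℓ
  have hℓ0 : 0 ≤ ℓ := by
    have e : ℓ = lg * ((M : ℝ) / 2 - 1 + 1 / M) := by rw [hℓ, hξ]; ring
    rw [e]
    refine mul_nonneg hlg0.le ?_
    have hM2r : (2 : ℝ) ≤ M := by exact_mod_cast hM2
    have : (0 : ℝ) < 1 / M := by positivity
    linarith
  -- the gap of the Chernoff exponent over `c log 2`
  set g : ℝ := (ξ * lam - ℓ) - c * lg with hg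
  have hgval : g = lg * (3 * δ / 4 - 1 / M) := by
    rw [hg, hℓ, hlam, hξ, hδ]
    field_simp
    ring
  have hg0 : 0 < g := by
    rw [hgval]
    refine mul_pos hlg0 ?_
    linarith
  -- the polynomial factor
  set B : ℝ := 4 * (ξ ^ 2 + 2) * Real.exp (ξ * M) + 8 / 3 with hB
  have hB0 : 0 < B := by positivity
  refine ⟨lam, ?_, ⌈12 * B / g ^ 3⌉₊ + 1, fun L hL => ?_⟩
  · have : 0 < δ / (2 * M) := by positivity
    rw [hlam]; linarith
  have hL1n : 1 ≤ L := by omega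
  have hL1 : (1 : ℝ) ≤ L := by exact_mod_cast hL1n
  have hL0 : (0 : ℝ) ≤ L := by positivity
  have hLB : 12 * B / g ^ 3 ≤ L :=
    (Nat.le_ceil _).trans (by exact_mod_cast (by omega : ⌈12 * B / g ^ 3⌉₊ ≤ L))
  -- (1) Chernoff and the moment bound
  have hch := measureReal_norm_powSumL_ge_le hξ0 L (lam * L)
  have hmom : expMoment ξ L ≤ Real.exp (ξ * M) * Real.exp (ℓ * L) := expMoment_le_exp_rate hM2 L
  have hceil : ((⌈(ξ * L) ^ 2⌉₊ + 1 : ℕ) : ℝ) ≤ (ξ * L) ^ 2 + 2 := by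
    have := Nat.ceil_lt_add_one (show 0 ≤ (ξ * L) ^ 2 by positivity)
    push_cast
    linarith
  have hK0 : (0 : ℝ) ≤ ((⌈(ξ * L) ^ 2⌉₊ + 1 : ℕ) : ℝ) := by positivity
  -- (2) `4 K E_L + 8/3 ≤ e^{ℓL} · B (L² + 1)`
  have hEℓ : 1 ≤ Real.exp (ℓ * L) := Real.one_le_exp (by positivity)
  have hpoly : 4 * ((⌈(ξ * L) ^ 2⌉₊ + 1 : ℕ) : ℝ) * expMoment ξ L + 8 / 3 ≤
      Real.exp (ℓ * L) * (B * ((L : ℝ) ^ 2 + 1)) := by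
    have h1 : 4 * ((⌈(ξ * L) ^ 2⌉₊ + 1 : ℕ) : ℝ) * expMoment ξ L ≤
        4 * ((ξ * L) ^ 2 + 2) * (Real.exp (ξ * M) * Real.exp (ℓ * L)) :=
      mul_le_mul (mul_le_mul_of_nonneg_left hceil (by norm_num)) hmom (expMoment_nonneg ξ L)
        (by positivity)
    have h2 : (ξ * L) ^ 2 + 2 ≤ (ξ ^ 2 + 2) * ((L : ℝ) ^ 2 + 1) := by
      have hnn : 0 ≤ ξ ^ 2 + 2 * (L : ℝ) ^ 2 := by positivity
      calc (ξ * L) ^ 2 + 2 = ξ ^ 2 * (L : ℝ) ^ 2 + 2 := by ring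
        _ ≤ ξ ^ 2 * (L : ℝ) ^ 2 + 2 + (ξ ^ 2 + 2 * (L : ℝ) ^ 2) := le_add_of_nonneg_right hnn
        _ = (ξ ^ 2 + 2) * ((L : ℝ) ^ 2 + 1) := by ring
    have h3 : 4 * ((ξ * L) ^ 2 + 2) * (Real.exp (ξ * M) * Real.exp (ℓ * L)) ≤
        4 * ((ξ ^ 2 + 2) * ((L : ℝ) ^ 2 + 1)) * (Real.exp (ξ * M) * Real.exp (ℓ * L)) :=
      mul_le_mul_of_nonneg_right (mul_le_mul_of_nonneg_left h2 (by norm_num)) (by positivity)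
    have h4 : (8 / 3 : ℝ) ≤ Real.exp (ℓ * L) * (8 / 3 * ((L : ℝ) ^ 2 + 1)) := by
      have hL2 : (0 : ℝ) ≤ (L : ℝ) ^ 2 := sq_nonneg _
      calc (8 / 3 : ℝ) ≤ 8 / 3 * ((L : ℝ) ^ 2 + 1) := by linarith
        _ = 1 * (8 / 3 * ((L : ℝ) ^ 2 + 1)) := (one_mul _).symm
        _ ≤ Real.exp (ℓ * L) * (8 / 3 * ((L : ℝ) ^ 2 + 1)) :=
            mul_le_mul_of_nonneg_right hEℓ (by positivity)
    calc 4 * ((⌈(ξ * L) ^ 2⌉₊ + 1 : ℕ) : ℝ) * expMoment ξ L + 8 / 3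
        ≤ 4 * ((ξ ^ 2 + 2) * ((L : ℝ) ^ 2 + 1)) * (Real.exp (ξ * M) * Real.exp (ℓ * L)) +
            Real.exp (ℓ * L) * (8 / 3 * ((L : ℝ) ^ 2 + 1)) := add_le_add (h1.trans h3) h4
      _ = Real.exp (ℓ * L) * (B * ((L : ℝ) ^ 2 + 1)) := by rw [hB]; ring
  -- (3) the exponential beats the polynomial: `B (L² + 1) ≤ e^{gL}` for `L ≥ L₀`
  have hexp : B * ((L : ℝ) ^ 2 + 1) ≤ Real.exp (g * L) := by
    have hx : 0 ≤ g * L := by positivity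
    have h1 := Real.pow_div_factorial_le_exp (g * L) hx 3
    have h3fac : ((Nat.factorial 3 : ℕ) : ℝ) = 6 := by norm_num [Nat.factorial]
    rw [h3fac] at h1
    -- `(gL)³/6 ≥ 2 B L² ≥ B (L² + 1)`
    have hg3 : 0 < g ^ 3 := by positivity
    have hgL : 12 * B ≤ g ^ 3 * L := by
      have := mul_le_mul_of_nonneg_left hLB hg3.le
      rwa [mul_div_cancel₀ _ hg3.ne'] at this
    have hL2 : (L : ℝ) ^ 2 + 1 ≤ 2 * (L : ℝ) ^ 2 := by
      have h := one_le_pow₀ (M₀ := ℝ) (n := 2) hL1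
      linarith
    calc B * ((L : ℝ) ^ 2 + 1) ≤ B * (2 * (L : ℝ) ^ 2) := mul_le_mul_of_nonneg_left hL2 hB0.le
      _ = (12 * B) * (L : ℝ) ^ 2 / 6 := by ring
      _ ≤ (g ^ 3 * L) * (L : ℝ) ^ 2 / 6 := by gcongr
      _ = (g * L) ^ 3 / 6 := by ring
      _ ≤ Real.exp (g * L) := h1
  -- (4) assemble: `vol ≤ e^{−ξλL} e^{ℓL} B(L²+1) = 2^{−cL} e^{−gL} B(L²+1) ≤ 2^{−cL}`
  have hsplit : Real.exp (-(ξ * (lam * L))) * Real.exp (ℓ * L) =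
      (2 : ℝ) ^ (-(c * L)) * Real.exp (-(g * L)) := by
    rw [Real.rpow_def_of_pos two_pos, ← hlg, ← Real.exp_add, ← Real.exp_add]
    congr 1
    rw [hg]; ring
  have h2c : 0 < (2 : ℝ) ^ (-(c * L)) := Real.rpow_pos_of_pos two_pos _
  calc volume.real {α : ℝ | α ∈ Set.Icc (0 : ℝ) 1 ∧ lam * L ≤ ‖powSumL L α‖}
      ≤ Real.exp (-(ξ * (lam * L))) *
          (4 * ((⌈(ξ * L) ^ 2⌉₊ + 1 : ℕ) : ℝ) * expMoment ξ L + 8 / 3) := hch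
    _ ≤ Real.exp (-(ξ * (lam * L))) * (Real.exp (ℓ * L) * (B * ((L : ℝ) ^ 2 + 1))) :=
        mul_le_mul_of_nonneg_left hpoly (Real.exp_pos _).le
    _ = (2 : ℝ) ^ (-(c * L)) * (Real.exp (-(g * L)) * (B * ((L : ℝ) ^ 2 + 1))) := by
        rw [← mul_assoc, hsplit, mul_assoc]
    _ ≤ (2 : ℝ) ^ (-(c * L)) * 1 := by
        refine mul_le_mul_of_nonneg_left ?_ h2c.le
        rw [Real.exp_neg, inv_mul_le_iff₀ (Real.exp_pos _), mul_one]
        exact hexp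
    _ = (2 : ℝ) ^ (-(c * L)) := mul_one _

end PintzRuzsa2003

end Literature.NumberTheory.Sieve

end
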